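import Summits.NavierStokesRegularity.NavierStokesRegularity.Theorems.LerayQuarterDissipationFiniteDissipationLiouvillePastDss
import Summits.NavierStokesRegularity.NavierStokesRegularity.Theorems.LerayQuarterDissipationFiniteDissipationLiouvillePersistenceSeq
import Mathlib.Analysis.SpecialFunctions.Log.Basic
import HarnessLib

/-!
# Crux `FiniteDissipationLiouville` (stmt-NavierStokesRegularity-22144): NEAR-ONE DSS EXCLUSION
# WITH A THRESHOLD DEPENDING ONLY ON `(C, K)` — every DSS blow-up scenario in the stratum `𝒟_{C,K}`
# has scaling factor `λ ≥ λ₀(C,K) > 1`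

Theorems file of route `LerayQuarterDissipation` (lead prover g6; `--supports` the crux; portrait
fact for the registered stub `stub_envelopeCriticalLiouville` of skeleton v10 — the past-DSS
sub-case, Bradshaw–Tsai OP 5.1). Navier–Stokes regularity is NOT proved by anything here.

The tree's near-one leaf `exists_pastDss_threshold` (lead g2, from Chae–Wolf 2017 Thms 1.1/1.3):
every member of `𝒟_{C,K}` that is `c`-DSS on the past has a threshold `c₁(w) > 1` — depending on
the member through its Chae–Wolf envelope constant — with `c < c₁(w) ⇒ w ≡ 0`. Here the threshold
is made UNIFORM ON THE STRATUM by compactness: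

* `exists_pastDss_threshold_unif` — **for all `C, K` there is `λ₀ = λ₀(C,K) > 1` such that every
  member of `𝒟_{C,K}` which is `c`-DSS on the past with `1 < c < λ₀` is regular at the apex**
  Proof: if singular `c_n`-DSS members with
  `c_n ↓ 1` existed, a KNSS limit across members (ns-lqd-p1, `Compactness.seqLimit`) would be
  singular (persistence, p591803) and `μ`-DSS on the past for EVERY `μ > 0`: for `μ ≥ 1` the
  integer powers `c_n^{⌊log μ / log c_n⌋} → μ` and each member is DSS with all powers of its factor
  (`pastDss_pow`), so locally uniform convergence passes the scaling law to the limit; `μ < 1` by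
  inversion. A field self-similar on the past extends to a self-similar Type-I ancient mild field,
  which vanishes (Tsai 1998, `q = ∞`; the tree's `eq_zero_of_isSelfSimilar`, lead g0) —
  contradiction.
* PORTRAIT (`pastDss_factor_ge_of_singular`): **the scaling factor of every SINGULAR past-DSS
  member of `𝒟_{C,K}` is `≥ λ₀(C,K)`** — the fine-ratio end of the DSS wall is empty UNIFORMLY on
  the stratum (Chae–Wolf's `λ_*(C_*)` is uniform in the space-time ENVELOPE constant `C_*`, which
  is not a parameter of `𝒟_{C,K}`; here the uniformity is in the stratum's own parameters).

HONEST FRAMING: `λ₀` comes from compactness, not explicit; the wall for `λ ≥ λ₀` is untouched.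

References: Chae–Wolf, arXiv:1610.09464, Thm. 1.3; Tsai, ARMA 143 (1998), Thm. 1;
Koch–Nadirashvili–Seregin–Šverák, Acta Math. 203 (2009), §4 (compactness of the class).
-/

noncomputable section

-- the summit and its single sub-problem share the name (CONVENTIONS §1), as in every Theorems file
set_option linter.dupNamespace false

namespace Summit.NavierStokesRegularity.NavierStokesRegularity.Theorems.FiniteDissipationLiouville.Birth

open MeasureTheory Set Filter Topology Metric Function
open Literature.Analysis Literature.Analysis.FluidPDE
open Summit.NavierStokesRegularity.NavierStokesRegularity.Theorems.FiniteDissipationLiouville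
open scoped ENNReal NNReal

/-! ### Tools: powers of the factor, and integer powers of factors `↓ 1` reaching every `μ ≥ 1` -/

/-- A field `c`-DSS on the past (`c > 0`) is `c^k`-DSS on the past for every `k : ℕ`. -/
theorem pastDss_pow {c : ℝ} (hc : 0 < c)
    {w : ℝ → EuclideanSpace ℝ (Fin 3) → EuclideanSpace ℝ (Fin 3)}
    (hpast : ∀ t : ℝ, t < 0 → ∀ x, c • w (c ^ 2 * t) (c • x) = w t x) :
    ∀ k : ℕ, ∀ t : ℝ, t < 0 → ∀ x, c ^ k • w ((c ^ k) ^ 2 * t) (c ^ k • x) = w t x := by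
  intro k
  induction k with
  | zero => intro t _ x; simp
  | succ k ih =>
    intro t ht x
    have hck : 0 < c ^ k := pow_pos hc k
    have ht' : (c ^ k) ^ 2 * t < 0 := mul_neg_of_pos_of_neg (by positivity) ht
    -- `c^{k+1} • w((c^{k+1})² t, c^{k+1} x) = c^k • (c • w(c² ((c^k)² t), c • (c^k x)))`
    have e1 : (c ^ (k + 1)) ^ 2 * t = c ^ 2 * ((c ^ k) ^ 2 * t) := by ring
    have e2 : c ^ (k + 1) • x = c • (c ^ k • x) := by rw [pow_succ, mul_comm, mul_smul]
    rw [e1, e2, pow_succ, mul_smul, hpast _ ht' _, ih t ht x]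

/-- For factors `c_j > 1` tending to `1` and any `μ ≥ 1`, the integer powers
`c_j ^ ⌊log μ / log c_j⌋₊` tend to `μ`. -/
theorem exists_pow_tendsto_of_tendsto_one {c : ℕ → ℝ} (hc1 : ∀ j, 1 < c j)
    (hct : Tendsto c atTop (𝓝 1)) {μ : ℝ} (hμ : 1 ≤ μ) :
    Tendsto (fun j => c j ^ ⌊Real.log μ / Real.log (c j)⌋₊) atTop (𝓝 μ) := by
  have hμ0 : 0 < μ := one_pos.trans_le hμ
  have hlc : ∀ j, 0 < Real.log (c j) := fun j => Real.log_pos (hc1 j)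
  have hlμ : 0 ≤ Real.log μ := Real.log_nonneg hμ
  -- the exponents `e_j = ⌊log μ / log c_j⌋ log c_j ∈ (log μ − log c_j, log μ]`
  set e : ℕ → ℝ := fun j => (⌊Real.log μ / Real.log (c j)⌋₊ : ℝ) * Real.log (c j) with he
  have hup : ∀ j, e j ≤ Real.log μ := fun j => by
    have h := Nat.floor_le (div_nonneg hlμ (hlc j).le)
    calc e j ≤ Real.log μ / Real.log (c j) * Real.log (c j) :=
          mul_le_mul_of_nonneg_right h (hlc j).le
      _ = Real.log μ := div_mul_cancel₀ _ (hlc j).ne'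
  have hlow : ∀ j, Real.log μ - Real.log (c j) ≤ e j := fun j => by
    have h := (Nat.lt_floor_add_one (Real.log μ / Real.log (c j))).le
    have h' : Real.log μ / Real.log (c j) * Real.log (c j) ≤
        ((⌊Real.log μ / Real.log (c j)⌋₊ : ℝ) + 1) * Real.log (c j) :=
      mul_le_mul_of_nonneg_right h (hlc j).le
    rw [div_mul_cancel₀ _ (hlc j).ne', add_mul, one_mul] at h'
    linarith
  -- `log c_j → 0`, so `e_j → log μ`
  have hlog : Tendsto (fun j => Real.log (c j)) atTop (𝓝 0) := by
    have h := (Real.continuousAt_log one_ne_zero).tendsto.comp hct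
    rwa [Real.log_one] at h
  have he_t : Tendsto e atTop (𝓝 (Real.log μ)) := by
    have h1 : Tendsto (fun j => Real.log μ - Real.log (c j)) atTop (𝓝 (Real.log μ)) := by
      have := (tendsto_const_nhds (x := Real.log μ) (f := (atTop : Filter ℕ))).sub hlog
      rwa [sub_zero] at this
    exact tendsto_of_tendsto_of_tendsto_of_le_of_le h1 tendsto_const_nhds hlow hup
  -- exponentiate
  have hexp : Tendsto (fun j => Real.exp (e j)) atTop (𝓝 μ) := by
    have h := (Real.continuous_exp.tendsto _).comp he_t
    rwa [Real.exp_log hμ0] at h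
  refine hexp.congr fun j => ?_
  rw [he]
  simp only
  rw [← Real.log_pow, Real.exp_log (pow_pos (one_pos.trans (hc1 j)) _)]

/-! ### Passing the scaling law to a KNSS limit -/

/-- **A locally uniform limit of fields that are DSS on the past with factors `μ_j → μ` is `μ`-DSS
on the past**: pointwise convergence at `(t, x)`, locally uniform convergence around `(μ²t, μx)`
and continuity of the limit. -/
theorem pastDss_of_tendsto {C : ℝ}
    {w : ℕ → ℝ → EuclideanSpace ℝ (Fin 3) → EuclideanSpace ℝ (Fin 3)}
    {W : ℝ → EuclideanSpace ℝ (Fin 3) → EuclideanSpace ℝ (Fin 3)} (hW : IsTypeIAncientMild C W)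
    (hunif : ∀ n : ℕ, TendstoUniformlyOn (fun j z => w j z.1 z.2) (fun z => W z.1 z.2)
      atTop (Icc (-((n : ℝ) + 2)) (-(1 / ((n : ℝ) + 2))) ×ˢ
        closedBall (0 : EuclideanSpace ℝ (Fin 3)) ((n : ℝ) + 2)))
    (hpt : ∀ t < 0, ∀ x, Tendsto (fun j => w j t x) atTop (𝓝 (W t x)))
    {μs : ℕ → ℝ} {μ : ℝ} (hμ : 0 < μ) (hμs : Tendsto μs atTop (𝓝 μ))
    (hdss : ∀ j, ∀ t : ℝ, t < 0 → ∀ x, μs j • w j (μs j ^ 2 * t) (μs j • x) = w j t x) :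
    ∀ t : ℝ, t < 0 → ∀ x, μ • W (μ ^ 2 * t) (μ • x) = W t x := by
  intro t ht x
  -- the moving points `p_j = (μ_j² t, μ_j x) → p = (μ² t, μ x)`, `p.1 < 0`
  set p : ℝ × EuclideanSpace ℝ (Fin 3) := (μ ^ 2 * t, μ • x) with hp
  have hp1 : μ ^ 2 * t < 0 := mul_neg_of_pos_of_neg (by positivity) ht
  have hpj : Tendsto (fun j => ((μs j ^ 2 * t, μs j • x) : ℝ × EuclideanSpace ℝ (Fin 3)))
      atTop (𝓝 p) :=
    ((hμs.pow 2).mul_const t).prodMk_nhds (hμs.smul_const x)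
  -- a slab `S_n` containing a neighbourhood of `p`
  obtain ⟨n, hn⟩ : ∃ n : ℕ, -((n : ℝ) + 2) < 2 * (μ ^ 2 * t) ∧ μ ^ 2 * t / 2 < -(1 / ((n : ℝ) + 2)) ∧
      ‖μ • x‖ + 1 < (n : ℝ) + 2 := by
    obtain ⟨n₁, hn₁⟩ := exists_nat_gt (-(2 * (μ ^ 2 * t)))
    obtain ⟨n₂, hn₂⟩ := exists_nat_gt (2 / -(μ ^ 2 * t))
    obtain ⟨n₃, hn₃⟩ := exists_nat_gt (‖μ • x‖ + 1)
    refine ⟨n₁ + n₂ + n₃, ?_, ?_, ?_⟩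
    · push_cast; linarith [Nat.cast_nonneg (α := ℝ) n₂, Nat.cast_nonneg (α := ℝ) n₃]
    · have hpos : 0 < -(μ ^ 2 * t) := by linarith
      have h2 : 2 / -(μ ^ 2 * t) < (n₁ : ℝ) + n₂ + n₃ + 2 := by
        linarith [Nat.cast_nonneg (α := ℝ) n₁, Nat.cast_nonneg (α := ℝ) n₃]
      rw [div_lt_iff₀ hpos] at h2
      have hN : (0 : ℝ) < (n₁ : ℝ) + n₂ + n₃ + 2 := by positivity
      have h3 : 1 / ((n₁ : ℝ) + n₂ + n₃ + 2) < -(μ ^ 2 * t) / 2 := by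
        rw [div_lt_iff₀ hN]; linarith
      push_cast
      linarith
    · push_cast; linarith [Nat.cast_nonneg (α := ℝ) n₁, Nat.cast_nonneg (α := ℝ) n₂]
  set S : Set (ℝ × EuclideanSpace ℝ (Fin 3)) :=
    Icc (-((n : ℝ) + 2)) (-(1 / ((n : ℝ) + 2))) ×ˢ closedBall (0 : EuclideanSpace ℝ (Fin 3)) ((n : ℝ) + 2)
    with hS
  -- the open box `Ioo (2p₁, p₁/2) × ball(μx, 1)` is a neighbourhood of `p` inside `S`
  have hbox : Ioo (2 * (μ ^ 2 * t)) (μ ^ 2 * t / 2) ×ˢ ball (μ • x) 1 ∈ 𝓝 p :=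
    prod_mem_nhds (Ioo_mem_nhds (by linarith) (by linarith)) (ball_mem_nhds _ one_pos)
  have hboxS : Ioo (2 * (μ ^ 2 * t)) (μ ^ 2 * t / 2) ×ˢ ball (μ • x) 1 ⊆ S := by
    rintro ⟨s, y⟩ ⟨hs, hy⟩
    refine ⟨⟨by linarith [hs.1], by linarith [hs.2]⟩, ?_⟩
    rw [mem_closedBall, dist_zero_right]
    rw [mem_ball, dist_eq_norm] at hy
    have : ‖y‖ ≤ ‖y - μ • x‖ + ‖μ • x‖ := by
      calc ‖y‖ = ‖(y - μ • x) + μ • x‖ := by rw [sub_add_cancel]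
        _ ≤ ‖y - μ • x‖ + ‖μ • x‖ := norm_add_le _ _
    linarith
  have hev_mem : ∀ᶠ j in atTop, ((μs j ^ 2 * t, μs j • x) : ℝ × EuclideanSpace ℝ (Fin 3)) ∈ S :=
    (hpj.eventually (eventually_mem_set.2 hbox)).mono fun j hj => hboxS hj
  -- `w_j(p_j) → W(p)`: uniform convergence on `S` + continuity of `W` at `p`
  have hWc : ContinuousAt (uncurry W) p :=
    hW.continuousOn_uncurry.continuousAt
      ((isOpen_Iio.prod isOpen_univ).mem_nhds ⟨hp1, mem_univ _⟩)
  have hlim1 : Tendsto (fun j => w j (μs j ^ 2 * t) (μs j • x)) atTop (𝓝 (W (μ ^ 2 * t) (μ • x))) := by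
    rw [Metric.tendsto_atTop]
    intro ε hε
    have hu := (Metric.tendstoUniformlyOn_iff.1 (hunif n)) (ε / 2) (half_pos hε)
    have hc := (Metric.tendsto_nhds.1 (hWc.tendsto.comp hpj)) (ε / 2) (half_pos hε)
    obtain ⟨N, hN⟩ := eventually_atTop.1 ((hu.and hc).and hev_mem)
    refine ⟨N, fun j hj => ?_⟩
    obtain ⟨⟨h1, h2⟩, h3⟩ := hN j hj
    have h1' := h1 _ h3
    simp only [Function.comp_apply, uncurry_apply_pair] at h2
    calc dist (w j (μs j ^ 2 * t) (μs j • x)) (W (μ ^ 2 * t) (μ • x))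
        ≤ dist (w j (μs j ^ 2 * t) (μs j • x)) (W (μs j ^ 2 * t) (μs j • x)) +
            dist (W (μs j ^ 2 * t) (μs j • x)) (W (μ ^ 2 * t) (μ • x)) := dist_triangle _ _ _
      _ < ε / 2 + ε / 2 := add_lt_add (by rw [dist_comm]; exact h1') h2
      _ = ε := by ring
  have hlim2 : Tendsto (fun j => μs j • w j (μs j ^ 2 * t) (μs j • x)) atTop
      (𝓝 (μ • W (μ ^ 2 * t) (μ • x))) := hμs.smul hlim1
  have hlim3 : Tendsto (fun j => μs j • w j (μs j ^ 2 * t) (μs j • x)) atTop (𝓝 (W t x)) :=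
    (hpt t ht x).congr fun j => (hdss j t ht x).symm
  exact tendsto_nhds_unique hlim2 hlim3

/-! ### The uniform near-one threshold -/

/-- **NEAR-ONE DSS EXCLUSION WITH A THRESHOLD DEPENDING ONLY ON `(C, K)`.** For all `C, K` there
is `λ₀ > 1` such that every member of the stratum `𝒟_{C,K}` which is `c`-DSS on the past,
`c • w (c²t) (c•x) = w t x` (`t < 0`), with `1 < c < λ₀` is NOT singular at the apex.
[cite: ChaeWolf2017RemovingDSS, Thm. 1.3 (arXiv p. 3)] [cite: Tsai1998, Thm. 1] -/
theorem exists_pastDss_threshold_unif (C K : ℝ) : ∃ lam₀ : ℝ, 1 < lam₀ ∧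
    ∀ (w : ℝ → EuclideanSpace ℝ (Fin 3) → EuclideanSpace ℝ (Fin 3)),
      IsTypeIAncientMild C w →
      (∀ s : ℝ, s < 0 → ∫⁻ x, ‖fderiv ℝ (w s) x‖ₑ ^ 2 ≤ ENNReal.ofReal (K / Real.sqrt (-s))) →
      ∀ c : ℝ, 1 < c → c < lam₀ →
      (∀ t : ℝ, t < 0 → ∀ x, c • w (c ^ 2 * t) (c • x) = w t x) →
      ¬ (∀ r > 0, ∀ M : ℝ, ∃ t ∈ Set.Ioo (-(r ^ 2)) (0 : ℝ),
          ∃ x ∈ Metric.ball (0 : EuclideanSpace ℝ (Fin 3)) r, M < ‖w t x‖) := by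
  by_contra hcon
  push Not at hcon
  -- ### singular members with factors `c_k ∈ (1, 1 + 1/(k+1))`
  have hseq : ∀ k : ℕ, ∃ (v : ℝ → EuclideanSpace ℝ (Fin 3) → EuclideanSpace ℝ (Fin 3)) (c : ℝ),
      IsTypeIAncientMild C v ∧
      (∀ s : ℝ, s < 0 → ∫⁻ x, ‖fderiv ℝ (v s) x‖ₑ ^ 2 ≤ ENNReal.ofReal (K / Real.sqrt (-s))) ∧
      1 < c ∧ c < 1 + 1 / ((k : ℝ) + 1) ∧
      (∀ t : ℝ, t < 0 → ∀ x, c • v (c ^ 2 * t) (c • x) = v t x) ∧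
      (∀ r > 0, ∀ M : ℝ, ∃ t ∈ Set.Ioo (-(r ^ 2)) (0 : ℝ),
          ∃ x ∈ Metric.ball (0 : EuclideanSpace ℝ (Fin 3)) r, M < ‖v t x‖) := by
    intro k
    obtain ⟨w, hw, hlaw, c, hc1, hc2, hpast, hsing⟩ :=
      hcon (1 + 1 / ((k : ℝ) + 1)) (lt_add_of_pos_right _ (by positivity))
    exact ⟨w, c, hw, hlaw, hc1, hc2, hpast, hsing⟩
  choose v c hv hvlaw hc1 hc2 hpast hvsing using hseq
  have hct : Tendsto c atTop (𝓝 1) := by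
    have h0 : Tendsto (fun k : ℕ => 1 + 1 / ((k : ℝ) + 1)) atTop (𝓝 1) := by
      have h1 : Tendsto (fun k : ℕ => 1 / ((k : ℝ) + 1)) atTop (𝓝 0) :=
        tendsto_const_nhds.div_atTop (tendsto_atTop_add_const_right _ _ tendsto_natCast_atTop_atTop)
      have h2 := (tendsto_const_nhds (x := (1 : ℝ)) (f := (atTop : Filter ℕ))).add h1
      simpa using h2
    exact tendsto_of_tendsto_of_tendsto_of_le_of_le tendsto_const_nhds h0
      (fun k => (hc1 k).le) (fun k => (hc2 k).le)
  -- ### KNSS compactness across members: a singular limit member `W ∈ 𝒟_{C,K}`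
  obtain ⟨ψ, hψ, W, hW, hunif, hpt, hgrad⟩ := Compactness.seqLimit hv
  have hψt : Tendsto ψ atTop atTop := hψ.tendsto_atTop
  have hWlaw : ∀ s : ℝ, s < 0 →
      ∫⁻ x, ‖fderiv ℝ (W s) x‖ₑ ^ 2 ≤ ENNReal.ofReal (K / Real.sqrt (-s)) :=
    Compactness.law_of_seqLimit (Kinf := K) (Kk := fun _ => K) hψt hvlaw
      (fun ε hε => Eventually.of_forall fun _ => by linarith) hgrad
  have hWsing := Compactness.persistent_singularity_seq (w := fun j => v (ψ j))
    (fun j => hv (ψ j)) (fun j => hvlaw (ψ j)) (fun j => hvsing (ψ j)) hW hunif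
  -- ### `W` is `μ`-DSS on the past for every `μ ≥ 1` …
  have hcψ1 : ∀ j, 1 < c (ψ j) := fun j => hc1 (ψ j)
  have hge : ∀ μ : ℝ, 1 ≤ μ → ∀ t : ℝ, t < 0 → ∀ x, μ • W (μ ^ 2 * t) (μ • x) = W t x := by
    intro μ hμ
    set kμ : ℕ → ℕ := fun j => ⌊Real.log μ / Real.log (c (ψ j))⌋₊ with hkμ
    have hμs : Tendsto (fun j => c (ψ j) ^ kμ j) atTop (𝓝 μ) :=
      exists_pow_tendsto_of_tendsto_one hcψ1 (hct.comp hψt) hμ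
    exact pastDss_of_tendsto hW hunif hpt (one_pos.trans_le hμ) hμs
      fun j => pastDss_pow (one_pos.trans (hcψ1 j)) (hpast (ψ j)) (kμ j)
  -- ### … and for every `μ ∈ (0, 1)` by inversion
  have hall : ∀ μ : ℝ, 0 < μ → ∀ t : ℝ, t < 0 → ∀ x, μ • W (μ ^ 2 * t) (μ • x) = W t x := by
    intro μ hμ t ht x
    rcases le_or_gt 1 μ with h1 | h1
    · exact hge μ h1 t ht x
    · have hμ' : 1 ≤ μ⁻¹ := (one_le_inv₀ hμ).2 h1.le
      have ht' : μ ^ 2 * t < 0 := mul_neg_of_pos_of_neg (by positivity) ht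
      have h := hge μ⁻¹ hμ' (μ ^ 2 * t) ht' (μ • x)
      rw [smul_smul, inv_mul_cancel₀ hμ.ne', one_smul, ← mul_assoc, ← mul_pow,
        inv_mul_cancel₀ hμ.ne', one_pow, one_mul] at h
      rw [← h, smul_smul, mul_inv_cancel₀ hμ.ne', one_smul]
  -- ### the self-similar extension vanishes (Tsai, `q = ∞`): contradiction with the singularity
  set W' : ℝ → EuclideanSpace ℝ (Fin 3) → EuclideanSpace ℝ (Fin 3) :=
    fun t x => if t < 0 then W t x else 0 with hW'
  have heq : ∀ t < 0, W' t = W t := fun t ht => funext fun x => by simp [hW', ht]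
  have hW'c : IsTypeIAncientMild C W' := CorkscrewProfile.Birth.isTypeIAncientMild_congr_neg hW heq
  have hss : IsSelfSimilar W' := by
    intro μ hμ
    funext t x
    rw [nsRescale_apply]
    by_cases ht : t < 0
    · have hμt : μ ^ 2 * t < 0 := mul_neg_of_pos_of_neg (by positivity) ht
      simp only [hW', ht, hμt, if_true, hall μ hμ t ht x]
    · have hμt : ¬ μ ^ 2 * t < 0 := fun h' => ht (by
        by_contra h''
        exact absurd h' (not_lt.2 (mul_nonneg (sq_nonneg μ) (not_lt.1 h''))))
      simp only [hW', ht, hμt, if_false, smul_zero]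
  have hzero := eq_zero_of_isSelfSimilar hW'c hss
  obtain ⟨t, ht, x, -, hM⟩ := hWsing 1 one_pos 0
  have h0 : W t x = 0 := by rw [← congrFun (heq t ht.2) x]; exact hzero t ht.2 x
  rw [h0, norm_zero] at hM
  exact lt_irrefl _ hM

/-- **PORTRAIT ENTRY (stub `stub_envelopeCriticalLiouville`, past-DSS sub-case): the scaling
factor of every SINGULAR past-DSS member of `𝒟_{C,K}` is at least `λ₀(C,K) > 1`** — the
fine-ratio end of the DSS wall is empty uniformly on the stratum. -/
theorem pastDss_factor_ge_of_singular (C K : ℝ) : ∃ lam₀ : ℝ, 1 < lam₀ ∧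
    ∀ (w : ℝ → EuclideanSpace ℝ (Fin 3) → EuclideanSpace ℝ (Fin 3)),
      IsTypeIAncientMild C w →
      (∀ s : ℝ, s < 0 → ∫⁻ x, ‖fderiv ℝ (w s) x‖ₑ ^ 2 ≤ ENNReal.ofReal (K / Real.sqrt (-s))) →
      (∀ r > 0, ∀ M : ℝ, ∃ t ∈ Set.Ioo (-(r ^ 2)) (0 : ℝ),
          ∃ x ∈ Metric.ball (0 : EuclideanSpace ℝ (Fin 3)) r, M < ‖w t x‖) →
      ∀ c : ℝ, 1 < c → (∀ t : ℝ, t < 0 → ∀ x, c • w (c ^ 2 * t) (c • x) = w t x) → lam₀ ≤ c := by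
  obtain ⟨lam₀, h1, h⟩ := exists_pastDss_threshold_unif C K
  refine ⟨lam₀, h1, fun w hw hlaw hsing c hc hpast => ?_⟩
  by_contra hlt
  push Not at hlt
  exact h w hw hlaw c hc hlt hpast hsing

end Summit.NavierStokesRegularity.NavierStokesRegularity.Theorems.FiniteDissipationLiouville.Birth

end
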